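import Summits.BirchSwinnertonDyer.BirchSwinnertonDyer.Theorems.ClassRecordThreeEulerHalvesAtThreeCartanSupplyNormOneSplit
import Summits.BirchSwinnertonDyer.BirchSwinnertonDyer.Theorems.ClassRecordThreeEulerHalvesAtThreeCartanSupplyFixedPointsP1
import HarnessLib

/-!
# SUPPLY, the NORM-ONE count `Σ_g χ_W(g)² = |GL₂(𝔽_q)|`, part 3: a non-split torus

Helper file `--supports stmt-BirchSwinnertonDyer-19109 --as helper` (seat `bsd-idea-10` g13; crux `EulerHalvesAtThree` ∕ child 23422 line `cartan` v11,
stub SUPPLY; toward the hypothesis `CubicNewvectorCharNormOne` of `cartanTorusLatticeSupply_of_virtual`). Continues parts 1–2. Fix `η` without rational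
eigenvalue and the non-split torus `T_C = nonsplitTorus η = {a + bη invertible}`. THIS FILE (all PROVED, `q` an ODD prime):
* §9 the TYPE of a non-scalar element of `T_C` (no rational eigenvalue, `nonsplitTorus_types`); `#{x ∈ T_C : x ~ g}` is `0` unless `g` is scalar or
  ELLIPTIC (no rational eigenvalue) and then exactly `2` (`card_nonsplitTorus_conj_of_elliptic`: the conjugates are the `a + bη` with prescribed trace
  and determinant, i.e. the two roots `±b` of `b²·Δ(η) = Δ(g)` — a square ratio of two non-squares, tree `hasRatEigenvalue_iff_isSquare_discr`);
* §10 `#{y : y⁻¹gy ∈ T_C}` pointwise (`|G|` ∕ `0` ∕ `2(q² − 1)`), the NON-SPLIT-TORUS IDENTITY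
  `|G|·Σ_{t ∈ T_C} F(t) = |G|·Σ_{g scalar} F(g) + 2(q² − 1)·Σ_{g elliptic} F(g)` for every class function `F` (`nonsplitTorus_identity`),
  and the count `2(q² − 1)·#{elliptic} = |G|·((q² − 1) − (q − 1))` (`count_elliptic`).
HONEST FRAMING: finite group ∕ finite-field bookkeeping only; NORM ONE itself is part 4; nothing about NUM, crux 23422 ∕ 19109 or any summit statement
is proved by this seat; BSD is proved for no curve. [folklore]
-/

set_option linter.dupNamespace false
set_option autoImplicit false

noncomputable section

namespace Summit.BirchSwinnertonDyer.BirchSwinnertonDyer.Theorems.CartanSupply.NormOne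

open Summit.BirchSwinnertonDyer.BirchSwinnertonDyer.Theorems.CartanDegree
open Summit.BirchSwinnertonDyer.BirchSwinnertonDyer.Theorems.CartanTorusCubeCut
open scoped Classical

variable {q : ℕ} [Fact q.Prime]

/-! ## §9 Conjugates inside a non-split torus -/

/-- PROVED: the trace of `a·1 + b·η` is `2a + b·tr η`. [folklore] -/
theorem trace_lin (η : Mat q) (p : ZMod q × ZMod q) : (lin η p).trace = 2 * p.1 + p.2 * η.trace := by
  simp only [lin, Matrix.trace_fin_two, Matrix.add_apply, Matrix.smul_apply, Matrix.one_apply_eq, smul_eq_mul, mul_one]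
  ring

/-- PROVED: a non-scalar element of a non-split torus is ELLIPTIC (no rational eigenvalue; tree `not_hasRatEigenvalue_lin`). [folklore] -/
theorem nonsplitTorus_types {η : Mat q} (hη : ¬ HasRatEigenvalue η) {x : G q} (hx : x ∈ nonsplitTorus η)
    (hns : ¬ IsScalarMat (x : Mat q)) : ¬ HasRatEigenvalue (x : Mat q) := by
  rw [nonsplitTorus_eq_image hη] at hx
  obtain ⟨p, hp, rfl⟩ := Finset.mem_image.1 hx
  have hp0 : p ≠ 0 := by simpa using hp
  rw [linGL_coe hη hp0] at hns ⊢
  exact not_hasRatEigenvalue_lin hη (fun h2 => hns ((isScalarMat_lin_iff hη p).2 h2))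

/-- PROVED: a non-scalar element WITH a rational eigenvalue has no conjugate in `T_C`. [folklore] -/
theorem card_nonsplitTorus_conj_of_not {η : Mat q} (hη : ¬ HasRatEigenvalue η) (g : G q) (hg : ¬ IsScalarMat (g : Mat q))
    (h : HasRatEigenvalue (g : Mat q)) :
    ((nonsplitTorus η).filter fun x => ∃ y : G q, y⁻¹ * g * y = x).card = 0 := by
  rw [Finset.card_eq_zero, Finset.filter_eq_empty_iff]
  rintro x hx ⟨y, rfl⟩
  have hns : ¬ IsScalarMat ((y⁻¹ * g * y : G q) : Mat q) := fun hs => hg ((isScalarMat_conj g y).1 hs)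
  exact nonsplitTorus_types hη hx hns ((hasRatEigenvalue_conj g y).2 h)

/-- PROVED: the torus point `((t − b·tr η)/2, b)` has trace `t`, and determinant `d` as soon as `b²·Δ_η = t² − 4d`. [folklore] -/
theorem lin_point (hq2 : q ≠ 2) (η : Mat q) (t d b : ZMod q) (hb : b ^ 2 * (η.trace ^ 2 - 4 * η.det) = t ^ 2 - 4 * d) :
    (lin η ((t - b * η.trace) * 2⁻¹, b)).trace = t ∧ (lin η ((t - b * η.trace) * 2⁻¹, b)).det = d := by
  have h2 := (ManinLocalTwoThree.SL2ZModOddPrime.neZero_two hq2).out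
  have h2a : 2 * ((t - b * η.trace) * 2⁻¹) = t - b * η.trace := by
    rw [mul_comm, inv_mul_cancel_right₀ h2]
  constructor
  · rw [trace_lin, h2a]; ring
  · have h4 : (4 : ZMod q) ≠ 0 := by
      have : (4 : ZMod q) = 2 * 2 := by norm_num
      rw [this]; exact mul_ne_zero h2 h2
    apply mul_left_cancel₀ h4
    rw [det_lin]
    linear_combination (2 * ((t - b * η.trace) * 2⁻¹) + (t - b * η.trace) + 2 * b * η.trace) * h2a - hb

/-- PROVED — **TWO CONJUGATES IN `T_C`**: an ELLIPTIC `g` has exactly two conjugates in the non-split torus `T_C = 𝔽_q[η]^×`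
(`q` odd: `Δ_g/Δ_η` is a square as both are non-squares; the conjugates are `a ± b₀η`). [folklore] -/
theorem card_nonsplitTorus_conj_of_elliptic (hq2 : q ≠ 2) {η : Mat q} (hη : ¬ HasRatEigenvalue η) (g : G q)
    (hg : ¬ HasRatEigenvalue (g : Mat q)) :
    ((nonsplitTorus η).filter fun x => ∃ y : G q, y⁻¹ * g * y = x).card = 2 := by
  have h2 := (ManinLocalTwoThree.SL2ZModOddPrime.neZero_two hq2).out
  have hgns : ¬ IsScalarMat (g : Mat q) := fun hs => hg (hasRatEigenvalue_of_isScalarMat hs)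
  have hΔg : ¬ IsSquare ((g : Mat q).trace ^ 2 - 4 * (g : Mat q).det) :=
    fun hs => hg ((FixedPoints.hasRatEigenvalue_iff_isSquare_discr h2 _).2 hs)
  have hΔη : ¬ IsSquare (η.trace ^ 2 - 4 * η.det) := fun hs => hη ((FixedPoints.hasRatEigenvalue_iff_isSquare_discr h2 _).2 hs)
  have hΔη0 : η.trace ^ 2 - 4 * η.det ≠ 0 := by intro h; rw [h] at hΔη; exact hΔη IsSquare.zero
  have hΔg0 : (g : Mat q).trace ^ 2 - 4 * (g : Mat q).det ≠ 0 := by intro h; rw [h] at hΔg; exact hΔg IsSquare.zero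
  obtain ⟨c, hc⟩ : IsSquare (((↑g : Mat q).trace ^ 2 - 4 * (↑g : Mat q).det) * (η.trace ^ 2 - 4 * η.det)) := by
    -- the product of two non-squares of `𝔽_q` is a square (quadratic character)
    set a := (↑g : Mat q).trace ^ 2 - 4 * (↑g : Mat q).det
    set b := η.trace ^ 2 - 4 * η.det
    have h1 : quadraticChar (ZMod q) a = -1 := (quadraticChar_neg_one_iff_not_isSquare).2 hΔg
    have h2' : quadraticChar (ZMod q) b = -1 := (quadraticChar_neg_one_iff_not_isSquare).2 hΔη
    have h3 : quadraticChar (ZMod q) (a * b) = 1 := by rw [map_mul, h1, h2']; norm_num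
    exact (quadraticChar_one_iff_isSquare (mul_ne_zero hΔg0 hΔη0)).1 h3
  -- b₀ := c / Δ_η satisfies b₀² Δ_η = Δ_g
  set b₀ : ZMod q := c * (η.trace ^ 2 - 4 * η.det)⁻¹ with hb₀def
  have hb₀ : b₀ ^ 2 * (η.trace ^ 2 - 4 * η.det) = (g : Mat q).trace ^ 2 - 4 * (g : Mat q).det := by
    rw [hb₀def]
    field_simp
    linear_combination -hc
  have hb₀' : (-b₀) ^ 2 * (η.trace ^ 2 - 4 * η.det) = (g : Mat q).trace ^ 2 - 4 * (g : Mat q).det := by rw [neg_sq]; exact hb₀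
  have hb₀0 : b₀ ≠ 0 := by
    intro h; apply hΔg0; rw [← hb₀, h]; ring
  have hbb : b₀ ≠ -b₀ := by
    intro h
    apply hb₀0
    have : (2 : ZMod q) * b₀ = 0 := by linear_combination h
    exact (mul_eq_zero.1 this).resolve_left h2
  -- the two torus points
  set pp : ZMod q × ZMod q := (((g : Mat q).trace - b₀ * η.trace) * 2⁻¹, b₀) with hpp
  set pm : ZMod q × ZMod q := (((g : Mat q).trace - (-b₀) * η.trace) * 2⁻¹, -b₀) with hpm
  have hpp0 : pp ≠ 0 := fun h => hb₀0 (by simpa [hpp] using congrArg Prod.snd h)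
  have hpm0 : pm ≠ 0 := fun h => hb₀0 (by simpa [hpm] using congrArg Prod.snd h)
  have hmemT : ∀ {p : ZMod q × ZMod q}, p ≠ 0 → linGL η hη p ∈ nonsplitTorus η := fun hp => by
    rw [nonsplitTorus_eq_image hη]
    exact Finset.mem_image_of_mem _ (Finset.mem_erase.2 ⟨hp, Finset.mem_univ _⟩)
  have hset : ((nonsplitTorus η).filter fun x => ∃ y : G q, y⁻¹ * g * y = x) = {linGL η hη pp, linGL η hη pm} := by
    ext x
    rw [Finset.mem_filter, conj_iff g x hgns, Finset.mem_insert, Finset.mem_singleton]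
    constructor
    · rintro ⟨hx, hns, ht, hd⟩
      rw [nonsplitTorus_eq_image hη] at hx
      obtain ⟨p, hp, rfl⟩ := Finset.mem_image.1 hx
      have hp0 : p ≠ 0 := by simpa using hp
      rw [linGL_coe hη hp0] at ht hd
      rw [trace_lin] at ht
      rw [det_lin] at hd
      -- p.2² Δ_η = Δ_g = b₀² Δ_η, so p.2 = ± b₀
      have hsq : p.2 ^ 2 * (η.trace ^ 2 - 4 * η.det) = (g : Mat q).trace ^ 2 - 4 * (g : Mat q).det := by
        linear_combination (2 * p.1 + p.2 * η.trace + (g : Mat q).trace) * ht - 4 * hd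
      have hfac : (p.2 - b₀) * (p.2 + b₀) * (η.trace ^ 2 - 4 * η.det) = 0 := by
        linear_combination hsq - hb₀
      rcases mul_eq_zero.1 hfac with hfac | hfac
      · rcases mul_eq_zero.1 hfac with h0 | h0
        · left
          have hp2 : p.2 = b₀ := sub_eq_zero.1 h0
          have hp1 : p.1 = ((g : Mat q).trace - b₀ * η.trace) * 2⁻¹ := by
            rw [← hp2, ← ht]
            field_simp
            ring
          rw [show p = pp from Prod.ext hp1 hp2]
        · right
          have hp2 : p.2 = -b₀ := eq_neg_of_add_eq_zero_left h0
          have hp1 : p.1 = ((g : Mat q).trace - (-b₀) * η.trace) * 2⁻¹ := by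
            rw [← hp2, ← ht]
            field_simp
            ring
          rw [show p = pm from Prod.ext hp1 hp2]
      · exact absurd hfac hΔη0
    · rintro (rfl | rfl)
      · obtain ⟨ht, hd⟩ := lin_point hq2 η (g : Mat q).trace (g : Mat q).det b₀ hb₀
        refine ⟨hmemT hpp0, ?_, ?_, ?_⟩
        · rw [linGL_coe hη hpp0, isScalarMat_lin_iff hη]; exact hb₀0
        · rw [linGL_coe hη hpp0]; exact ht
        · rw [linGL_coe hη hpp0]; exact hd
      · obtain ⟨ht, hd⟩ := lin_point hq2 η (g : Mat q).trace (g : Mat q).det (-b₀) hb₀'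
        refine ⟨hmemT hpm0, ?_, ?_, ?_⟩
        · rw [linGL_coe hη hpm0, isScalarMat_lin_iff hη]; exact neg_ne_zero.2 hb₀0
        · rw [linGL_coe hη hpm0]; exact ht
        · rw [linGL_coe hη hpm0]; exact hd
  rw [hset, Finset.card_insert_of_notMem, Finset.card_singleton]
  rw [Finset.mem_singleton]
  intro e
  have e' := congrArg (fun x : G q => (x : Mat q)) e
  simp only [linGL_coe hη hpp0, linGL_coe hη hpm0] at e'
  have := congrArg Prod.snd (lin_injective hη e')
  exact hbb (by simpa [hpp, hpm] using this)

/-! ## §10 `#{y : y⁻¹gy ∈ T_C}` pointwise, and the non-split-torus identity -/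

/-- PROVED: a scalar element lies in every non-split torus. [folklore] -/
theorem mem_nonsplitTorus_of_isScalar (η : Mat q) {g : G q} (hs : IsScalarMat (g : Mat q)) : g ∈ nonsplitTorus η := by
  obtain ⟨c, hc⟩ := (PS.isScalarMat_iff_eq_smul_one (g : Mat q)).1 hs
  simp only [nonsplitTorus, Finset.mem_filter, Finset.mem_univ, true_and, hc, Matrix.smul_mul, Matrix.mul_smul,
    Matrix.one_mul, Matrix.mul_one]

/-- PROVED — **`S_C` POINTWISE**: `#{y : y⁻¹gy ∈ T_C}` is `|G|` for scalar `g`, `2(q − 1)(q + 1)` for elliptic `g`, and `0` otherwise. [folklore] -/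
theorem card_conj_mem_nonsplitTorus (hq2 : q ≠ 2) {η : Mat q} (hη : ¬ HasRatEigenvalue η) (g : G q) :
    (Finset.univ.filter fun y : G q => y⁻¹ * g * y ∈ nonsplitTorus η).card =
      if IsScalarMat (g : Mat q) then Fintype.card (G q)
      else if HasRatEigenvalue (g : Mat q) then 0 else 2 * ((q - 1) * (q + 1)) := by
  split_ifs with hs hr
  · exact card_conj_mem_of_isScalar _ g hs (mem_nonsplitTorus_of_isScalar η hs)
  · rw [card_conj_mem, card_nonsplitTorus_conj_of_not hη g hs hr, mul_zero]
  · rw [card_conj_mem, card_centralizer_of_not_hasRatEigenvalue g hr, card_nonsplitTorus_conj_of_elliptic hq2 hη g hr]; ring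

/-- PROVED — **THE NON-SPLIT-TORUS IDENTITY**: for a class function `F`,
`|G|·Σ_{x ∈ T_C} F(x) = |G|·Σ_{g scalar} F(g) + 2(q − 1)(q + 1)·Σ_{g elliptic} F(g)`. [folklore] -/
theorem nonsplitTorus_identity (hq2 : q ≠ 2) {η : Mat q} (hη : ¬ HasRatEigenvalue η) (F : G q → ℤ)
    (hcl : ∀ a b, F (a * b) = F (b * a)) :
    (Fintype.card (G q) : ℤ) * ∑ x ∈ nonsplitTorus η, F x =
      (Fintype.card (G q) : ℤ) * ∑ g ∈ Finset.univ.filter (fun g : G q => IsScalarMat (g : Mat q)), F g +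
        2 * (((q : ℤ) - 1) * ((q : ℤ) + 1)) * ∑ g ∈ Finset.univ.filter (fun g : G q => ¬ HasRatEigenvalue (g : Mat q)), F g := by
  have hq1 : ((q - 1 : ℕ) : ℤ) = (q : ℤ) - 1 := by
    rw [Nat.cast_sub (Fact.out : q.Prime).one_le]; simp
  rw [← sum_mul_card_conj_mem (nonsplitTorus η) F hcl, Finset.sum_filter, Finset.sum_filter, Finset.mul_sum, Finset.mul_sum,
    ← Finset.sum_add_distrib]
  refine Finset.sum_congr rfl (fun g _ => ?_)
  rw [card_conj_mem_nonsplitTorus hq2 hη g]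
  by_cases hs : IsScalarMat (g : Mat q)
  · have hr : HasRatEigenvalue (g : Mat q) := hasRatEigenvalue_of_isScalarMat hs
    rw [if_pos hs, if_pos hs, if_neg (not_not.2 hr), mul_zero, add_zero, mul_comm]
  · by_cases hr : HasRatEigenvalue (g : Mat q)
    · rw [if_neg hs, if_neg hs, if_pos hr, if_neg (not_not.2 hr), Nat.cast_zero, mul_zero, mul_zero, mul_zero, add_zero]
    · rw [if_neg hs, if_neg hs, if_neg hr, if_pos hr, mul_zero, zero_add, Nat.cast_mul, Nat.cast_mul, Nat.cast_add, hq1, Nat.cast_ofNat,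
        Nat.cast_one, mul_comm]

/-- PROVED — **THE ELLIPTIC COUNT**: `2(q − 1)(q + 1)·#{elliptic} = |G|·((q − 1)(q + 1) − (q − 1))`. [folklore] -/
theorem count_elliptic (hq2 : q ≠ 2) :
    2 * (((q : ℤ) - 1) * ((q : ℤ) + 1)) * ((Finset.univ.filter fun g : G q => ¬ HasRatEigenvalue (g : Mat q)).card : ℤ) =
      (Fintype.card (G q) : ℤ) * (((q : ℤ) - 1) * ((q : ℤ) + 1) - ((q : ℤ) - 1)) := by
  have hq1 : ((q - 1 : ℕ) : ℤ) = (q : ℤ) - 1 := by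
    rw [Nat.cast_sub (Fact.out : q.Prime).one_le]; simp
  obtain ⟨η, hη⟩ := exists_not_hasRatEigenvalue hq2
  have h := nonsplitTorus_identity hq2 hη (fun _ => 1) (fun _ _ => rfl)
  simp only [Finset.sum_const, nsmul_eq_mul, mul_one, nonsplitTorus_card hη, card_scalar, Nat.cast_mul, Nat.cast_add,
    Nat.cast_one, hq1] at h
  linear_combination -h

end Summit.BirchSwinnertonDyer.BirchSwinnertonDyer.Theorems.CartanSupply.NormOne

end
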